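import Summits.BirchSwinnertonDyer.Rank2.TwoIsogenyPlantedRankKernel
import Summits.BirchSwinnertonDyer.Rank2.Family81517Defs
import HarnessLib

/-!
# A kernel rank-`3` certificate on the odd `8-15-17` family (planner p2 GEN 39; landed by lead star-p1 GEN 14)

The door `T-r3₂` (`Rank2.Family81517.SelmerCorankEqOrderEqThreeOnOddFamily`, route
`EisensteinDepletionAtTwo`) predicts `corank_{ℤ₂} Sel_{2^∞} = 3` for every odd member of the family.
Here we certify, UNCONDITIONALLY and in the kernel, that the odd member `(j, n) = (337, 120)`
(`m = 2699`, `q = 924299`, `r = 4164299`) has Mordell–Weil rank `≥ 3`, by the `2`-isogeny descent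
count of `Rank2.TwoIsogenyPlantedRankKernel`: `#α(E(ℚ)) ≥ 4` (planted) and `#α'(E'(ℚ)) ≥ 8` (planted
`T'`, `Q₁ = (−25q, 600nq)` and the THIRD point `Q₃ = (4205, 54000320)` of
`E' : y² = x³ + 34q x² + 225 m q x`, found by PARI `ellrank`, kit job j321661), and
`#α · #α' = 2^{rank+2}` [Silverman–Tate §3.6].

No new axioms; `lean check` rc 0, 0 sorries. BSD is not proved by this file; it is numerical-kernel
evidence for the door's prediction on one member (with the door T-r3₂ — `DoorEndState.selmerCorankEqOrderEqThreeOnOddFamily_of_namedFacts`,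
conditional on eleven named published facts — it gives rank = corank Sel_{2^∞} = 3 and #Ш[2^∞] < ∞ for THIS member; PARTITION D-0054:
none — one curve, no S0 motion).
-/

set_option linter.dupNamespace false
set_option autoImplicit false

namespace Summit.BirchSwinnertonDyer.BirchSwinnertonDyer.Theorems.Family81517Rank3Cert

open scoped Classical
open _root_.WeierstrassCurve
open _root_.WeierstrassCurve.Affine (SqUnits sqClass sqClass_mul sqClass_sq sqClass_eq_one_iff)
open Literature.NumberTheory.EllipticCurves
open Summit.BirchSwinnertonDyer.Rank2

/-! ## The member `(j, n) = (337, 120)`: `m = 2699`, `q = 924299`, `r = 4164299` -/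

/-- `m = 8·337 + 3 = 2699` is prime. [folklore] -/
theorem prime_m : (2699 : ℕ).Prime := by norm_num
/-- `q = m + 64·120² = 924299` is prime. [folklore] -/
theorem prime_q : (924299 : ℕ).Prime := by norm_num
/-- `r = m + 289·120² = 4164299` is prime. [folklore] -/
theorem prime_r : (4164299 : ℕ).Prime := by norm_num
/-- `q = m + 64 n²` at `(m, n) = (2699, 120)`. [folklore] -/
theorem q_eq : ((924299 : ℕ) : ℤ) = (2699 : ℕ) + 64 * (120 : ℤ) ^ 2 := by norm_num
/-- `r = m + 289 n²` at `(m, n) = (2699, 120)`. [folklore] -/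
theorem r_eq : ((4164299 : ℕ) : ℤ) = (2699 : ℕ) + 289 * (120 : ℤ) ^ 2 := by norm_num

/-! ## Helpers (square classes of squarefree integers) -/

/-- `d` with `|d| = p₁ p₂` (distinct primes) is squarefree. [folklore] -/
theorem squarefree_of_natAbs_eq_mul {d : ℤ} {p₁ p₂ : ℕ} (h : d.natAbs = p₁ * p₂) (h₁ : p₁.Prime)
    (h₂ : p₂.Prime) (hne : p₁ ≠ p₂) : Squarefree d := by
  refine Int.squarefree_natAbs.mp ?_
  rw [h, Nat.squarefree_mul ((Nat.coprime_primes h₁ h₂).mpr hne)]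
  exact ⟨h₁.squarefree, h₂.squarefree⟩

/-- `d` with `|d| = p₁ p₂ p₃` (pairwise distinct primes) is squarefree. [folklore] -/
theorem squarefree_of_natAbs_eq_mul₃ {d : ℤ} {p₁ p₂ p₃ : ℕ} (h : d.natAbs = p₁ * p₂ * p₃)
    (h₁ : p₁.Prime) (h₂ : p₂.Prime) (h₃ : p₃.Prime) (h₁₂ : p₁ ≠ p₂) (h₁₃ : p₁ ≠ p₃) (h₂₃ : p₂ ≠ p₃) :
    Squarefree d := by
  refine Int.squarefree_natAbs.mp ?_
  have hc : (p₁ * p₂).Coprime p₃ :=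
    Nat.coprime_mul_iff_left.mpr ⟨(Nat.coprime_primes h₁ h₃).mpr h₁₃, (Nat.coprime_primes h₂ h₃).mpr h₂₃⟩
  rw [h, Nat.squarefree_mul hc, Nat.squarefree_mul ((Nat.coprime_primes h₁ h₂).mpr h₁₂)]
  exact ⟨⟨h₁.squarefree, h₂.squarefree⟩, h₃.squarefree⟩

/-- `d` with `|d| = p` prime is squarefree. [folklore] -/
theorem squarefree_of_natAbs_eq_prime {d : ℤ} {p : ℕ} (h : d.natAbs = p) (hp : p.Prime) :
    Squarefree d :=
  Int.squarefree_natAbs.mp (h ▸ hp.squarefree)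

/-- A rational solution of `y² = x³ + a x² + b x` is a nonsingular point of `E_{a,b}`. [folklore] -/
theorem nonsingular_of_eq {a b x y : ℚ} [(⟨0, a, 0, b, 0⟩ : WeierstrassCurve ℚ).IsElliptic]
    (hy : y ^ 2 = x ^ 3 + a * x ^ 2 + b * x) :
    (⟨0, a, 0, b, 0⟩ : WeierstrassCurve ℚ).toAffine.Nonsingular x y := by
  refine Affine.equation_iff_nonsingular.mp ?_
  rw [Affine.equation_iff]
  show y ^ 2 + 0 * x * y + 0 * y = x ^ 3 + a * x ^ 2 + b * x + 0
  linear_combination hy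

/-- A rational point `(x, y)`, `x ≠ 0`, of `E_{a,b}` puts `[x]` into `α(E_{a,b}(ℚ))`. [folklore] -/
theorem sqClass_mem_range_of_eq {a b x y : ℚ} [(⟨0, a, 0, b, 0⟩ : WeierstrassCurve ℚ).IsElliptic]
    (hy : y ^ 2 = x ^ 3 + a * x ^ 2 + b * x) (hx : x ≠ 0) :
    sqClass x ∈ Set.range (⟨0, a, 0, b, 0⟩ : WeierstrassCurve ℚ).xSqClass :=
  ⟨.some x y (nonsingular_of_eq hy), xSqClass_some_of_ne_zero _ hx⟩

/-! ## Eight classes in `α'(E'(ℚ))`, `E' = E_{34q, 225mq}` -/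

/-- **`#α'(E'(ℚ)) ≥ 8`** for the member `(337, 120)`: the classes of the squarefree integers
`{1, mq, −q, −m, 5, 5mq, −5q, −5m}` all lie in `α'(E'(ℚ))` — from `O`, `T' ↦ [225mq] = [mq]`,
`Q₁ = (−25q, 600·120·q) ↦ [−q]`, `Q₃ = (4205, 54000320) ↦ [4205] = [5·29²] = [5]`, and products.
[folklore: Silverman–Tate §3.5–3.6; the point `Q₃` from PARI `ellrank` (kit j321661)] -/
theorem eight_classes' :
    ∃ S : Finset (SqUnits ℚ), (S : Set (SqUnits ℚ)) ⊆
      Set.range (⟨0, ((34 * (924299 : ℕ) : ℤ) : ℚ), 0, ((225 * (2699 : ℕ) * (924299 : ℕ) : ℤ) : ℚ), 0⟩ :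
        WeierstrassCurve ℚ).xSqClass ∧ S.card = 8 := by
  haveI := isElliptic_mk_of_ne_zero (F := ℚ) (family81517_hab' prime_m prime_q prime_r q_eq r_eq)
  set W := (⟨0, ((34 * (924299 : ℕ) : ℤ) : ℚ), 0, ((225 * (2699 : ℕ) * (924299 : ℕ) : ℤ) : ℚ), 0⟩ :
    WeierstrassCurve ℚ) with hW
  have ha : (((34 * (924299 : ℕ) : ℤ)) : ℚ) = 31426166 := by norm_num
  have hb : (((225 * (2699 : ℕ) * (924299 : ℕ) : ℤ)) : ℚ) = 561303675225 := by norm_num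
  -- the generators
  have hs1 : sqClass (((1 : ℤ)) : ℚ) ∈ Set.range W.xSqClass := by
    refine ⟨0, ?_⟩
    rw [xSqClass_zero, Int.cast_one]
    exact ((sqClass_eq_one_iff one_ne_zero).mpr ⟨1, by norm_num⟩).symm
  have hT : sqClass (((2494683001 : ℤ)) : ℚ) ∈ Set.range W.xSqClass := by
    refine ⟨W.twoTorsionPoint, ?_⟩
    rw [xSqClass_twoTorsionPoint]
    show sqClass ((((225 * (2699 : ℕ) * (924299 : ℕ) : ℤ)) : ℚ)) = _
    rw [show (225 * (2699 : ℕ) * (924299 : ℕ) : ℤ) = 2494683001 * 15 ^ 2 by norm_num,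
      sqClass_mul_sq_intCast (by norm_num) (by norm_num)]
  have hQ1 : sqClass (((-924299 : ℤ)) : ℚ) ∈ Set.range W.xSqClass := by
    have h := sqClass_mem_range_of_eq (a := (((34 * (924299 : ℕ) : ℤ)) : ℚ))
      (b := (((225 * (2699 : ℕ) * (924299 : ℕ) : ℤ)) : ℚ)) (x := (((-924299 * 5 ^ 2 : ℤ)) : ℚ))
      (y := 66549528000) (by rw [ha, hb]; norm_num) (by norm_num)
    rwa [sqClass_mul_sq_intCast (by norm_num) (by norm_num)] at h
  have hQ3 : sqClass (((5 : ℤ)) : ℚ) ∈ Set.range W.xSqClass := by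
    have h := sqClass_mem_range_of_eq (a := (((34 * (924299 : ℕ) : ℤ)) : ℚ))
      (b := (((225 * (2699 : ℕ) * (924299 : ℕ) : ℤ)) : ℚ)) (x := (((5 * 29 ^ 2 : ℤ)) : ℚ))
      (y := 54000320) (by rw [ha, hb]; norm_num) (by norm_num)
    rwa [sqClass_mul_sq_intCast (by norm_num) (by norm_num)] at h
  -- products
  have hmul : ∀ {d₁ d₂ : ℤ}, d₁ ≠ 0 → d₂ ≠ 0 → sqClass ((d₁ : ℤ) : ℚ) ∈ Set.range W.xSqClass →
      sqClass ((d₂ : ℤ) : ℚ) ∈ Set.range W.xSqClass →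
        sqClass (((d₁ * d₂ : ℤ)) : ℚ) ∈ Set.range W.xSqClass := by
    intro d₁ d₂ h₁ h₂ hm₁ hm₂
    have h := mul_mem_range_xSqClass W hm₁ hm₂
    rwa [← sqClass_mul (by exact_mod_cast h₁) (by exact_mod_cast h₂), ← Int.cast_mul] at h
  have hTQ1 : sqClass (((-2699 : ℤ)) : ℚ) ∈ Set.range W.xSqClass := by
    have h := hmul (by norm_num) (by norm_num) hT hQ1
    rwa [show ((2494683001 : ℤ) * -924299 : ℤ) = -2699 * 924299 ^ 2 by norm_num,
      sqClass_mul_sq_intCast (by norm_num) (by norm_num)] at h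
  have hTQ3 : sqClass (((12473415005 : ℤ)) : ℚ) ∈ Set.range W.xSqClass := by
    have h := hmul (by norm_num) (by norm_num) hQ3 hT
    rwa [show ((5 : ℤ) * 2494683001 : ℤ) = 12473415005 by norm_num] at h
  have hQ1Q3 : sqClass (((-4621495 : ℤ)) : ℚ) ∈ Set.range W.xSqClass := by
    have h := hmul (by norm_num) (by norm_num) hQ3 hQ1
    rwa [show ((5 : ℤ) * -924299 : ℤ) = -4621495 by norm_num] at h
  have hTQ1Q3 : sqClass (((-13495 : ℤ)) : ℚ) ∈ Set.range W.xSqClass := by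
    have h := hmul (by norm_num) (by norm_num) hQ3 hTQ1
    rwa [show ((5 : ℤ) * -2699 : ℤ) = -13495 by norm_num] at h
  -- squarefreeness of the eight representatives
  have p5 : (5 : ℕ).Prime := by norm_num
  have hsqf : ∀ d ∈ ({1, 2494683001, -924299, -2699, 5, 12473415005, -4621495, -13495} : Finset ℤ),
      Squarefree d := by
    intro d hd
    simp only [Finset.mem_insert, Finset.mem_singleton] at hd
    rcases hd with rfl | rfl | rfl | rfl | rfl | rfl | rfl | rfl
    · exact squarefree_one
    · exact squarefree_of_natAbs_eq_mul (p₁ := 2699) (p₂ := 924299) (by norm_num) prime_m prime_q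
        (by norm_num)
    · exact squarefree_of_natAbs_eq_prime (p := 924299) (by norm_num) prime_q
    · exact squarefree_of_natAbs_eq_prime (p := 2699) (by norm_num) prime_m
    · exact squarefree_of_natAbs_eq_prime (p := 5) (by norm_num) p5
    · exact squarefree_of_natAbs_eq_mul₃ (p₁ := 5) (p₂ := 2699) (p₃ := 924299) (by norm_num) p5
        prime_m prime_q (by norm_num) (by norm_num) (by norm_num)
    · exact squarefree_of_natAbs_eq_mul (p₁ := 5) (p₂ := 924299) (by norm_num) p5 prime_q
        (by norm_num)
    · exact squarefree_of_natAbs_eq_mul (p₁ := 5) (p₂ := 2699) (by norm_num) p5 prime_m (by norm_num)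
  have hsub : (↑(({1, 2494683001, -924299, -2699, 5, 12473415005, -4621495, -13495} : Finset ℤ).image
      fun d : ℤ => sqClass (d : ℚ)) : Set (SqUnits ℚ)) ⊆ Set.range W.xSqClass := by
    intro c hc
    obtain ⟨d, hd, rfl⟩ := Finset.mem_image.mp (Finset.mem_coe.mp hc)
    simp only [Finset.mem_insert, Finset.mem_singleton] at hd
    rcases hd with rfl | rfl | rfl | rfl | rfl | rfl | rfl | rfl
    · exact hs1
    · exact hT
    · exact hQ1
    · exact hTQ1
    · exact hQ3
    · exact hTQ3
    · exact hQ1Q3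
    · exact hTQ1Q3
  refine ⟨({1, 2494683001, -924299, -2699, 5, 12473415005, -4621495, -13495} : Finset ℤ).image
    fun d : ℤ => sqClass (d : ℚ), hsub, ?_⟩
  rw [Finset.card_image_of_injOn (fun d₁ h₁ d₂ h₂ he =>
    eq_of_sqClass_intCast_eq (hsqf d₁ h₁) (hsqf d₂ h₂) he)]
  decide

/-! ## The rank bound -/

/-- **Rank `≥ 3` for the odd member `(337, 120)`** on the normal-form model
`E : y² = x³ − 17q x² + 16 q r x`: `#α(E(ℚ)) ≥ 4` (planted, tree), `#α'(E'(ℚ)) ≥ 8` (above), hence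
`2 + 3 ≤ rank + 2`. [folklore: Silverman–Tate §3.6] -/
theorem three_le_mordellWeilRank_member :
    3 ≤ (⟨0, ((-17 * (924299 : ℕ) : ℤ) : ℚ), 0, ((16 * (924299 : ℕ) * (4164299 : ℕ) : ℤ) : ℚ), 0⟩ :
      WeierstrassCurve ℚ).mordellWeilRank := by
  haveI := isElliptic_family81517 (n := 120) prime_m prime_q prime_r q_eq r_eq
  obtain ⟨S, hS, hS4⟩ := family81517_four_classes prime_m prime_q prime_r (by norm_num) q_eq r_eq
  obtain ⟨S', hS', hS8⟩ := eight_classes'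
  rw [← family81517_codomain q_eq r_eq] at hS'
  have h := add_le_mordellWeilRank_add_two_of_card_le _ hS hS' (i := 2) (j := 3)
    (by rw [hS4]; norm_num) (by rw [hS8]; norm_num)
  omega

/-- **Rank `≥ 3` for the member in the family's `a₁ = 1` model** `curve 337 120 =
⟨1, −3928271, 0, q r, 0⟩` (`4A = −17q − 1`), transported by the change of variables
`(u, r, s, t) = (2, 0, 1, 0)` [AEC III.3.1(b), tree `mordellWeilRank_variableChange_holds`]. -/
theorem three_le_mordellWeilRank_curve :
    3 ≤ (Family81517.curve 337 120).mordellWeilRank := by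
  have key := three_le_mordellWeilRank_member
  have hA : 4 * (-3928271 : ℤ) = -17 * (924299 : ℕ) - 1 := by norm_num
  set C : VariableChange ℚ := ⟨Units.mk0 (2 : ℚ) two_ne_zero, 0, 1, 0⟩ with hC
  set E : WeierstrassCurve ℚ :=
    ⟨0, ((-17 * (924299 : ℕ) : ℤ) : ℚ), 0, ((16 * (924299 : ℕ) * (4164299 : ℕ) : ℤ) : ℚ), 0⟩ with hE
  have hinv : (C • E).mordellWeilRank = E.mordellWeilRank := mordellWeilRank_variableChange_holds E C
  rw [hC, hE, variableChange_family81517 (r := 4164299) hA] at hinv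
  have hcurve : Family81517.curve 337 120 =
      ⟨1, ((-3928271 : ℤ) : ℚ), 0, ((((924299 : ℕ) : ℤ) * (4164299 : ℕ) : ℤ) : ℚ), 0⟩ := by
    simp only [Family81517.curve, Family81517.qOf, Family81517.rOf]
    norm_num
  rw [hcurve, hinv]
  exact key

/-- **The member is an ODD DOOR MEMBER with unconditional rank `≥ 3`**: `AdmissibleF 337 120`,
`OddSign 337 120` (`q ≡ 2 (mod 3)`, `q ≡ 4 (mod 5)`, root number `−1`), and `3 ≤ rank`, the value the
door `T-r3₂` predicts for `corank Sel_{2^∞}` (which bounds the rank from above). [this file] -/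
theorem oddMember_three_le_rank :
    Family81517.AdmissibleF 337 120 ∧ Family81517.OddSign 337 120 ∧
      3 ≤ (Family81517.curve 337 120).mordellWeilRank := by
  refine ⟨?_, ?_, three_le_mordellWeilRank_curve⟩
  · simp only [Family81517.AdmissibleF, Family81517.qOf, Family81517.rOf, Family81517.mOf]
    refine ⟨by norm_num, ?_, by norm_num, by norm_num, ?_, ?_⟩
    · exact Int.prime_iff_natAbs_prime.mpr (by norm_num)
    · exact Int.prime_iff_natAbs_prime.mpr (by norm_num)
    · exact Int.prime_iff_natAbs_prime.mpr (by norm_num)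
  · simp only [Family81517.OddSign, Family81517.qOf]
    norm_num

end Summit.BirchSwinnertonDyer.BirchSwinnertonDyer.Theorems.Family81517Rank3Cert
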